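import Literature.AnabelianGeometry.EtaleTheta.ThetaSubquotientOfTemperedPsiTransport
import Literature.AnabelianGeometry.EtaleTheta.ThetaSubquotientLevelN
import Literature.AnabelianGeometry.EtaleTheta.FrobenioidThetaOfBiKummerData
import Literature.AnabelianGeometry.EtaleTheta.Discharge.Sec5AutTransportIdentity

/-!
# [EtTh] Thm. 5.6 (i), T56-L09c at the CARRIER level DISCHARGED: the compatibility law `hδc` of the level-`N` end knit for
# abc-iut-w5-d013's transport `psiTransport`, from the base-shadow law `hθ`, the normalisation `hc₁` and [SemiAnbd] Prop. 3.2's `η`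

Mochizuki, *The étale theta function and its Frobenioid-theoretic manifestations*, Publ. RIMS **45** (2009), Thm. 5.6 proof p. 329
(PDF p. 103) («`Ψ` preserves `(l·Δ_Θ)_{(−)}`»; «hence [cf. [SemiAnbd], Prop. 3.2] an outer automorphism of the tempered fundamental group»).
[cite: MochizukiEtTh2009, Thm 5.6 p.328–329 (PDF pp.102–103)]  abc-iut cell, layer L2, row K4 «SUBDAG-Thm56» — T56-L03 step 2, FILE B of
option (c) (seat abc-iut-w5-d034, gen 5).  PROOF-ONLY (no definitions; the producers are consumed BY NAME).

`ThetaFrobenioid.deltaCompat_carrier_of_psiTransport` — over ANY §4 setting `S` on `B^temp(Π^tp_X)⁰` and any `N`-th root `R`: for a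
self-equivalence `Ψ` of `C` with base `Ψ^bs`, `eΨ : Ψ ⋙ Base ≅ Base ⋙ Ψ^bs`, transports `α : Ψ(A_N) ≅ A_N`, `β : Ψ(B_N) ≅ B_N` normalised by
`hc₁ : α⁻¹ ≫ Ψ(s^⊓_N) ≫ β = s^⊓_N` (abc-iut-L2-d4 / abc-iut-w5-d245, `D_c = 1`), a section `sec` of `Aut_C(A_N) → Aut_D(A_N^bs)` ([FrdI]
Prop. 5.6, the constructed `s^trv_N`), the [SemiAnbd] Prop. 3.2 datum `(φ, η)` of `Ψ^bs` with its level-`N` descent `(φQ, φΛ, hq, hι)`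
(abc-iut-w5-d013, p435495 / p438441), and EVERY base shadow `θA` with the knit's law `hθ : Base(α⁻¹ ≫ Ψ f ≫ α) = θA (Base f)`:
for `g ∈ autPre q_N ι_N (B_N^bs)` (print's `Aut`-subquotient domain),

  `map ((β)^bs) (psiTransport_{B_N} (autProj ⟨g⟩)) = autProj ⟨(s'_N)^bs-conjugate of θA at g⟩`

— EXACTLY the binder `hδc` of abc-iut-w5-d034's `…_ofConnectedTemperoidData_levelN_carrier` (`Sec5Thm56EndKnitLevelNCarrier`) at
`δ := psiTransport q_N ι_N φ φQ φΛ hq hι Ψ^bs η (−)^bs (Ψ −)^bs (eΨ.app −)` (the lift inside abc-iut-w5-d020's `deltaTransport`, p443762).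
Ingredients, BY NAME: abc-iut-w5-d013's `psiTransport_autProj` (T56-L09c at the carrier) and `map_autProj_iso`; abc-iut-w5-d020's generic
base identity `AutTransport.mapIso_conjAut_transport_eq` (p445329), fed with (i) `hθ` extended to ALL of `Aut_D(A_N^bs)` through the section
`sec` and the naturality of `eΨ` (abc-iut-w5-d013's computation in `Sec5GaloisShadowOfBaseShadow`, here in `Iso.conjAut` form) and (ii) `hc₁`
read on bases through `eΨ`.  Consumer note: apply with EXPLICIT universes (`.{u₀, v₀, w}`) — see the elaboration note of
`Sec5Thm56EndKnitLevelNCarrier`.  HONEST FRAMING: kernel-checked implications between typed statements about abc-iut-L2-t9's carrier and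
abc-iut-L2-t4's setting; nothing asserts that such data exist for an actual curve; typed ≠ discharged; no side taken on [IUTchIII] Cor. 3.12.
-/

noncomputable section

namespace Literature.AnabelianGeometry.EtaleTheta

namespace ThetaFrobenioid

open CategoryTheory Opposite Literature.AlgebraicGeometry.Frobenioids Literature.AnabelianGeometry.SemiGraphs
  Literature.AnabelianGeometry.SemiGraphs.GaloisObjects

universe u₀ v₀ w

variable {K : Type u₀} [Field K] {X : SemiGraphs.TemperedArithmeticGroup.{u₀} K} {D₀ : Type u₀} [Category.{v₀} D₀]
  {V : FrdIMonoidStub.{w}} {T₀ : RealifiedDivisorMonoids (D₀ := D₀) V}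
  {VD : FrdICatStub.{u₀ + 1, u₀, w} (ConnectedPart (BTemp X.Pi))}
  {S : BiKummerSetting X T₀ (ConnectedPart (BTemp X.Pi)) VD}
  {pullFrac : ∀ {A A' : S.C} (_ : A' ⟶ A), S.biratUnits A → S.biratUnits A'}
  {lv N : ℕ+} {θ : S.biratUnits S.Aodot} {Bl : S.C} {Pl : S.FractionPair θ Bl} {Rl : S.NthRoot θ Pl lv pullFrac}
  (R : S.NthRoot Rl.root Rl.pair N pullFrac)
  (Ψ : S.C ≌ S.C) (Ψbs : ConnectedPart (BTemp X.Pi) ⥤ ConnectedPart (BTemp X.Pi))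

/-- **The base-shadow law on ALL of `Aut_D(A_N^bs)`, in `Iso.conjAut` form**: with `ea : (Ψ A_N)^bs ≅ Ψ^bs(A_N^bs)` natural on endomorphisms
of `A_N` (the component of `eΨ`) and a section `sec` of `Aut_C(A_N) → Aut_D(A_N^bs)`, the knit's law `hθ` gives
`θA τ = ((ea)⁻¹ ≫ Base α)`-conjugate of `Ψ^bs(τ)` for every `τ` (abc-iut-w5-d013's computation). [cite: MochizukiEtTh2009, Thm 5.6 proof p.328 (PDF p.102)] -/
theorem baseShadow_eq_conjAut (sec : Aut R.AN.base → Aut R.AN) (hsec : ∀ τ : Aut R.AN.base, ModelFrobenioid.baseMap (sec τ).hom = τ.hom)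
    (ea : S.base.obj (Ψ.functor.obj R.AN) ≅ Ψbs.obj R.AN.base)
    (hna : ∀ f : R.AN ⟶ R.AN, S.base.map (Ψ.functor.map f) ≫ ea.hom = ea.hom ≫ Ψbs.map (ModelFrobenioid.baseMap f))
    (α : Ψ.functor.obj R.AN ≅ R.AN) (θA : Aut R.AN.base ≃* Aut R.AN.base)
    (hθ : ∀ f : Aut R.AN, (PreFrobenioid.baseFunctor S.F).mapIso (α.symm ≪≫ Ψ.functor.mapIso f ≪≫ α) =
      θA ((PreFrobenioid.baseFunctor S.F).mapIso f)) (τ : Aut R.AN.base) :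
    θA τ = (ea.symm ≪≫ S.base.mapIso α).conjAut (Ψbs.mapIso τ) := by
  have h1 : θA τ = (PreFrobenioid.baseFunctor S.F).mapIso (α.symm ≪≫ Ψ.functor.mapIso (sec τ) ≪≫ α) := by
    rw [hθ (sec τ), show (PreFrobenioid.baseFunctor S.F).mapIso (sec τ) = τ from Iso.ext (hsec τ)]
  have h4 : S.base.map (Ψ.functor.map (sec τ).hom) = ea.hom ≫ Ψbs.map τ.hom ≫ ea.inv := by
    rw [← hsec τ, ← Category.assoc, ← hna (sec τ).hom, Category.assoc, Iso.hom_inv_id, Category.comp_id]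
  rw [h1, Iso.conjAut_apply]
  apply Iso.ext
  change S.base.map (α.inv ≫ Ψ.functor.map (sec τ).hom ≫ α.hom) = (S.base.map α.inv ≫ ea.hom) ≫ Ψbs.map τ.hom ≫ ea.inv ≫ S.base.map α.hom
  rw [Functor.map_comp, Functor.map_comp, h4]
  simp only [Category.assoc]

/-- **The normalisation `hc₁` read on bases** through the (natural) components `ea`, `eb` of `eΨ`:
`(Base α)⁻¹ ≫ ea ≫ Ψ^bs((s^⊓_N)^bs) ≫ eb⁻¹ ≫ Base β = (s^⊓_N)^bs`. [cite: MochizukiEtTh2009, Thm 5.6 proof p.329 (PDF p.103)] -/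
theorem base_normalisation_of_hc₁ (ea : S.base.obj (Ψ.functor.obj R.AN) ≅ Ψbs.obj R.AN.base)
    (eb : S.base.obj (Ψ.functor.obj R.BN) ≅ Ψbs.obj R.BN.base)
    (hnab : S.base.map (Ψ.functor.map R.pair.num) ≫ eb.hom = ea.hom ≫ Ψbs.map (ModelFrobenioid.baseMap R.pair.num))
    (α : Ψ.functor.obj R.AN ≅ R.AN) (β : Ψ.functor.obj R.BN ≅ R.BN) (hc₁ : α.inv ≫ Ψ.functor.map R.pair.num ≫ β.hom = R.pair.num) :
    (S.base.mapIso α).inv ≫ ea.hom ≫ Ψbs.map (BiKummerSetting.NthRoot.baseIso S R).hom ≫ eb.inv ≫ (S.base.mapIso β).hom =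
      (BiKummerSetting.NthRoot.baseIso S R).hom := by
  have h2 : S.base.map (Ψ.functor.map R.pair.num) = ea.hom ≫ Ψbs.map (ModelFrobenioid.baseMap R.pair.num) ≫ eb.inv := by
    rw [← Category.assoc, ← hnab, Category.assoc, Iso.hom_inv_id, Category.comp_id]
  have h3 := congrArg S.base.map hc₁
  rw [Functor.map_comp, Functor.map_comp, h2] at h3
  change S.base.map α.inv ≫ ea.hom ≫ Ψbs.map (ModelFrobenioid.baseMap R.pair.num) ≫ eb.inv ≫ S.base.map β.hom =
    S.base.map R.pair.num
  simpa only [Category.assoc] using h3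

/-- `(s.conjAut)⁻¹ = (s⁻¹).conjAut` pointwise (bookkeeping for abc-iut-L2-t4's `autBaseIsoAB := ((s^⊓_N)^bs).conjAut`).
[cite: MochizukiEtTh2009, §5 p.331 (PDF p.105)] -/
theorem conjAut_symm_apply_baseIso (g : Aut R.BN.base) :
    (BiKummerSetting.NthRoot.baseIso S R).conjAut.symm g = (BiKummerSetting.NthRoot.baseIso S R).symm.conjAut g :=
  (BiKummerSetting.NthRoot.baseIso S R).conjAut.injective (by
    rw [MulEquiv.apply_symm_apply, ← Iso.trans_conjAut, Iso.symm_self_id, Iso.conjAut_apply]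
    ext
    simp)

variable {l' : ℕ} {RD : RigidData.{max u₀ w} N l'} (ιX : RD.PiX ≃ₜ* X.Pi)

set_option maxHeartbeats 400000 in
/-- **T56-L09c at the CARRIER level DISCHARGED for `psiTransport`** — the binder `hδc` of the level-`N` end knit
`…_ofConnectedTemperoidData_levelN_carrier`: at `B_N^bs`, `map (β^bs) ∘ psiTransport_{B_N} ∘ autProj = autProj ∘ θ′` on `autPre q_N ι_N (B_N^bs)`,
`θ′ := (s'_N)^bs-conjugate` of the base shadow `θA`.  [cite: MochizukiEtTh2009, Thm 5.6 proof p.329 (PDF p.103)] -/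
theorem deltaCompat_carrier_of_psiTransport [RD.iotaN.range.Normal]
    (sec : Aut R.AN.base → Aut R.AN) (hsec : ∀ τ : Aut R.AN.base, ModelFrobenioid.baseMap (sec τ).hom = τ.hom)
    (eΨ : Ψ.functor ⋙ S.base ≅ S.base ⋙ Ψbs) (α : Ψ.functor.obj R.AN ≅ R.AN) (β : Ψ.functor.obj R.BN ≅ R.BN)
    (hc₁ : α.inv ≫ Ψ.functor.map R.pair.num ≫ β.hom = R.pair.num)
    (φ : X.Pi ≃ₜ* X.Pi) (η : Ψbs ⋙ (connectedObjects (BTemp X.Pi)).ι ≅ (connectedObjects (BTemp X.Pi)).ι ⋙ BTemp.res (φ : X.Pi →ₜ* X.Pi))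
    (φQ : RD.LevelQuot ≃* RD.LevelQuot) (φΛ : RD.mu ≃* RD.mu) (hq : ∀ g : X.Pi, RD.qN ιX (φ g) = φQ (RD.qN ιX g))
    (hι : ∀ a : RD.mu, RD.iotaN (φΛ a) = φQ (RD.iotaN a))
    (θA : Aut R.AN.base ≃* Aut R.AN.base)
    (hθ : ∀ f : Aut R.AN, (PreFrobenioid.baseFunctor S.F).mapIso (α.symm ≪≫ Ψ.functor.mapIso f ≪≫ α) =
      θA ((PreFrobenioid.baseFunctor S.F).mapIso f))
    (g : Aut R.BN.base)
    (hg : Functor.mapAut R.BN.base (connectedObjects (BTemp X.Pi)).ι g ∈ ThetaSubquotient.autPre (RD.qN ιX) RD.iotaN R.BN.base.obj) :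
    ∃ hθg : Functor.mapAut R.BN.base (connectedObjects (BTemp X.Pi)).ι
          ((BiKummerSetting.NthRoot.baseIso S R).conjAut (θA ((BiKummerSetting.NthRoot.baseIso S R).conjAut.symm g))) ∈
        ThetaSubquotient.autPre (RD.qN ιX) RD.iotaN R.BN.base.obj,
      ThetaSubquotient.map (RD.qN ιX) RD.iotaN (Ψ.functor.obj R.BN).base.property R.BN.base.property (S.base.map β.hom).hom
          (ThetaSubquotient.psiTransport (RD.qN ιX) RD.iotaN φ φQ φΛ hq hι Ψbs η R.BN.base (Ψ.functor.obj R.BN).base (eΨ.app R.BN)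
            (ThetaSubquotient.autProj (RD.qN ιX) RD.iotaN R.BN.base.obj ⟨_, hg⟩)) =
        ThetaSubquotient.autProj (RD.qN ιX) RD.iotaN R.BN.base.obj ⟨_, hθg⟩ := by
  -- the base identity (abc-iut-w5-d020's generic `AutTransport.mapIso_conjAut_transport_eq`, p445329) at the §5 data
  have hident : (connectedObjects (BTemp X.Pi)).ι.mapIso ((BiKummerSetting.NthRoot.baseIso S R).conjAut
        (θA ((BiKummerSetting.NthRoot.baseIso S R).symm.conjAut g))) =
      ((η.app R.BN.base).symm ≪≫ (connectedObjects (BTemp X.Pi)).ι.mapIso (eΨ.app R.BN).symm ≪≫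
          (connectedObjects (BTemp X.Pi)).ι.mapIso (S.base.mapIso β)).conjAut
        ((BTemp.res (φ : X.Pi →ₜ* X.Pi)).mapIso ((connectedObjects (BTemp X.Pi)).ι.mapIso g)) :=
    AutTransport.mapIso_conjAut_transport_eq (connectedObjects (BTemp X.Pi)).ι Ψbs (BTemp.res (φ : X.Pi →ₜ* X.Pi))
      (BiKummerSetting.NthRoot.baseIso S R) (eΨ.app R.AN) (eΨ.app R.BN) (S.base.mapIso α) (S.base.mapIso β) θA
      (baseShadow_eq_conjAut R Ψ Ψbs sec hsec (eΨ.app R.AN) (fun f => eΨ.hom.naturality f) α θA hθ)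
      (base_normalisation_of_hc₁ R Ψ Ψbs (eΨ.app R.AN) (eΨ.app R.BN) (eΨ.hom.naturality R.pair.num) α β hc₁) g
      (η.app R.BN.base) (η.hom.naturality g.hom)
  have hθg : Functor.mapAut R.BN.base (connectedObjects (BTemp X.Pi)).ι
        ((BiKummerSetting.NthRoot.baseIso S R).conjAut (θA ((BiKummerSetting.NthRoot.baseIso S R).conjAut.symm g))) ∈
      ThetaSubquotient.autPre (RD.qN ιX) RD.iotaN R.BN.base.obj := by
    change (connectedObjects (BTemp X.Pi)).ι.mapIso _ ∈ _
    rw [conjAut_symm_apply_baseIso R g, hident]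
    exact ThetaSubquotient.conjAut_mem_autPre (RD.qN ιX) RD.iotaN _
      (ThetaSubquotient.mapIso_res_mem_autPre (RD.qN ιX) RD.iotaN φ φQ φΛ hq hι _ hg)
  refine ⟨hθg, ?_⟩
  rw [ThetaSubquotient.psiTransport_autProj]
  refine (ThetaSubquotient.map_autProj_iso (RD.qN ιX) RD.iotaN _ _
    ((connectedObjects (BTemp X.Pi)).ι.mapIso (S.base.mapIso β)) ⟨_, _⟩).trans ?_
  congr 1
  apply Subtype.ext
  change _ = (connectedObjects (BTemp X.Pi)).ι.mapIso
    ((BiKummerSetting.NthRoot.baseIso S R).conjAut (θA ((BiKummerSetting.NthRoot.baseIso S R).conjAut.symm g)))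
  rw [conjAut_symm_apply_baseIso R g, hident]
  -- `(A ≪≫ B ≪≫ C).conjAut = C.conjAut ∘ B.conjAut ∘ A.conjAut` (stated by `exact`, not `rw`: the implicit objects of the composites
  -- agree only up to unfolding `Functor.comp` / `S.base`)
  exact ((Iso.trans_conjAut (η.app R.BN.base).symm
      ((connectedObjects (BTemp X.Pi)).ι.mapIso (eΨ.app R.BN).symm ≪≫ (connectedObjects (BTemp X.Pi)).ι.mapIso (S.base.mapIso β))
      ((BTemp.res (φ : X.Pi →ₜ* X.Pi)).mapIso ((connectedObjects (BTemp X.Pi)).ι.mapIso g))).trans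
    (Iso.trans_conjAut ((connectedObjects (BTemp X.Pi)).ι.mapIso (eΨ.app R.BN).symm)
      ((connectedObjects (BTemp X.Pi)).ι.mapIso (S.base.mapIso β))
      ((η.app R.BN.base).symm.conjAut ((BTemp.res (φ : X.Pi →ₜ* X.Pi)).mapIso ((connectedObjects (BTemp X.Pi)).ι.mapIso g))))).symm

end ThetaFrobenioid

end Literature.AnabelianGeometry.EtaleTheta

end
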